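import Summits.QuantumFields.YangMills.Theorems.UnitScaleTiltProp7NumericWindowsInhabited
import HarnessLib

/-!
# Route `UnitScaleTilt`, crux K1 child «MinimiserStabilityRegPr» (stmt-QuantumFields-19200), stub `stub_existenceMinimalOrbit` (EX), route (α) — **«NUMERICS-CENSUS» KERNEL CERTIFICATE, COMPOSITE FORM**:
# S14ᴰ's L-only numeric rows (S13ᴰ's twelve ✓p682315 + RC-OF-ROWS' ✓p682625) TOGETHER WITH the PROP4-W80 door's numerals `hR16 hC4` (✓p683940 `Prop7Prop4OfW80RowsAtRecord.prop4_W80_family`, engine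
# lit ✓`B11Eq98W80Composite.quadAnalytic_W80_composite`) are JOINTLY INHABITED with the `prop4` constant `C₄` a WITNESS (EX namer WORD (15) 2026-08-29; memo `NUMERICS-CENSUS-px14g3.md` ec96f60532af6d0e)

Cell `ym3-torus`, width seat `ym3-torus-px14` (gen 3).  THEOREMS ONLY (0 `def`, 0 `sorry`); `--supports stmt-QuantumFields-19200 --as helper`; count-neutral.  YM₃ on T³ is a ladder rung (R3),
NOT the Clay problem; nothing here claims the stub, the crux, d = 4 or the mass gap.  PURE REAL ARITHMETIC over the sibling file's row lemmas.

WHAT IS PROVED (sorry-free, no definition).  ★★★ `numericWindows_inhabited_family_composite` — for all positive `B₀ ≤ bH`, nonnegative N06 letters `cC c137 kTJ k349 c137π k139π`, nonnegative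
composite∕W6 letters `N₁ θ₃ θE θE′ CV : ℕ → ℝ` and `Mρ Mτ ≥ 0`: there are `ef α a₃ r ε′ εC C₄ M : ℕ → ℝ` (positive on `1 < L`, `εC ≥ 0`) with the NINETEEN rows `hWQ hWe hWε hMe hw137 hq47 hR6 hrε2 hrα hr4
hr16 hMdoor hεC hdomC hselfC hcontrC hR16 hC4` in the displays' binder shapes VERBATIM (regime constant `bH`; at `bH := B₀` read `hbH := le_rfl`).  Witnesses: `ef := (356·10⁷·L³)⁻¹`,
`a₃ := εC := ef∕(8000(bH+1))`, `C₄ :=` the composite constant at the bars `(α, C₂, ℓ) ↦ (1, 720∕ef, 25∕7)` plus `1`, `r := min(a₃∕4, (16B₀C₄)⁻¹)`, `M :=` the (136)-door polynomial at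
`(720∕ef, α₀ := ef∕(2700L))`, `α := ½·min(min(α₀, ef∕M), min(r∕(2B₀), (13·10¹⁴L³)⁻¹))`, `ε′ := 2(r + 2B₀α)` — so `α ~ 10⁻⁴·ef²∕(N₁B₀²(1+cC))` (memo §5(a)).
HONEST SCOPE.  Arithmetic only: the numeric rows of S15 := S14ᴰ ∘ PROP4-W80 do not contradict each other for ANY values of the N06∕W6 letters; nothing about those letters' suppliers.

References: T. Bałaban, CMP **102** (1985) 277–309 [Balaban1985Variational] (Thm 1 p.279, (77) p.290, Prop. 4 (97)–(98) pp.292–293, (118)–(121) p.295, (136)–(140) pp.298–299).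
-/

set_option autoImplicit false

noncomputable section

namespace Summit.QuantumFields.YangMills.Theorems.Prop7NumericWindowsInhabited

/-- ★★★ **«NUMERICS-CENSUS», COMPOSITE FORM — S14ᴰ's numeric rows (S13ᴰ's twelve + RC-OF-ROWS' four + `hbH`) TOGETHER WITH THE PROP4-W80 DOOR's `hR16 hC4` (✓p683940) ARE JOINTLY INHABITED
WITH `C₄` A WITNESS**, for all positive `B₀ ≤ bH`, nonnegative N06 letters `cC c137 kTJ k349 c137π k139π`, nonnegative W6∕composite letters `N₁ θ₃ θE θE′ CV : ℕ → ℝ` and `Mρ Mτ ≥ 0`: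
there are `ef α a₃ r ε′ εC C₄ M : ℕ → ℝ` (positive on `1 < L`, `εC ≥ 0`) with the NINETEEN rows `hWQ hWe hWε hMe hw137 hq47 hR6 hrε2 hrα hr4 hr16 hMdoor hεC hdomC hselfC hcontrC` + `hR16 hC4` in the
displays' binder shapes VERBATIM (regime constant `bH`; at `bH := B₀` read `hbH := le_rfl`).  Witnesses as in §2 plus `C₄ :=` the composite constant at the bars `(α, C₂, ℓ) ↦ (1, 720∕ef, 25∕7)` `+ 1`
(memo §2 step 4; `α ~ 10⁻⁴·ef²∕(N₁B₀²(1+cC))` results).  So S15's numeric rows do not contradict each other for ANY values of the N06∕W6 letters.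
[cite: Balaban1985Variational, Thm 1 p.279, (77) p.290, Prop. 4 (97)–(98) pp.292–293, (118)–(121) p.295, (136)–(140) pp.298–299] -/
theorem numericWindows_inhabited_family_composite
    (B₀ bH cC c137 kTJ k349 c137π k139π N₁ θ₃ θE θE' CV : ℕ → ℝ) (Mρ Mτ : ℝ) (hB₀ : ∀ L, 1 < L → 0 < B₀ L) (hbH : ∀ L : ℕ, 1 < L → B₀ L ≤ bH L)
    (hk : ∀ L : ℕ, 1 < L → 0 ≤ cC L ∧ 0 ≤ c137 L ∧ 0 ≤ kTJ L ∧ 0 ≤ k349 L ∧ 0 ≤ c137π L ∧ 0 ≤ k139π L)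
    (hN₁0 : ∀ L, 1 < L → 0 ≤ N₁ L) (hθ₃ : ∀ L, 1 < L → 0 ≤ θ₃ L) (hθE : ∀ L, 1 < L → 0 ≤ θE L) (hθE' : ∀ L, 1 < L → 0 ≤ θE' L) (hCV : ∀ L, 1 < L → 0 ≤ CV L)
    (hMρ0 : 0 ≤ Mρ) (hMτ0 : 0 ≤ Mτ) :
    ∃ ef α a₃ r ε' εC C₄ M : ℕ → ℝ,
      (∀ L, 1 < L → 0 < ef L) ∧ (∀ L, 1 < L → 0 < α L) ∧ (∀ L, 1 < L → 0 < a₃ L) ∧ (∀ L, 1 < L → 0 < r L) ∧ (∀ L, 1 < L → 0 < C₄ L) ∧ (∀ L, 1 < L → 0 < M L) ∧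
      -- hWQ hWe hWε hMe hw137
      (∀ L : ℕ, 1 < L → 13 * 10 ^ 14 * (L : ℝ) ^ 3 * α L ≤ 1) ∧ (∀ L : ℕ, 1 < L → 10 ^ 9 * (L : ℝ) ^ 2 * ef L ≤ 1) ∧ (∀ L : ℕ, 1 < L → 10 ^ 12 * (L : ℝ) ^ 3 * α L ≤ 1) ∧
      (∀ L, 1 < L → M L * α L < ef L) ∧ (∀ L : ℕ, 1 < L → 10 ^ 7 * (L : ℝ) ^ 3 * (178 * (α L + ef L)) ≤ 1) ∧
      -- hq47 hR6 hrε2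
      (∀ L : ℕ, 1 < L → 9 * (40 * (2 * (3 * (2 * ef L + 2700 * (L : ℝ) * α L))) / ef L ^ 2) * B₀ L * ε' L < 1) ∧ (∀ L : ℕ, 1 < L → 6 * ε' L ≤ ef L) ∧
      (∀ L : ℕ, 1 < L → 2 * (r L + 2 * B₀ L * α L) ≤ ε' L) ∧
      -- hrα hr4 hr16
      (∀ L : ℕ, 1 < L → 2 * B₀ L * α L ≤ r L) ∧ (∀ L : ℕ, 1 < L → 4 * r L ≤ a₃ L) ∧ (∀ L : ℕ, 1 < L → 16 * B₀ L * C₄ L * r L ≤ 1) ∧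
      -- hMdoor
      (∀ L : ℕ, 1 < L → 11 * B₀ L + 4 * B₀ L * (40 * (2 * (3 * (2 * ef L + 2700 * (L : ℝ) * α L))) / ef L ^ 2) * (11 * B₀ L) ^ 2 * α L + ((1 + 25 * C₄ L * B₀ L ^ 2) + cC L * (1 + 25 * C₄ L * B₀ L ^ 2) + c137 L * 2 + kTJ L * (10 * B₀ L) / 2 + 14 * (10 * B₀ L) + k349 L * (10 * B₀ L) / 2 + 2 * (10 * B₀ L)) + 100 * (c137π L + k139π L * B₀ L + k349 L * B₀ L + (28 + 4) * α L * B₀ L) * (40 * (2 * (3 * (2 * ef L + 2700 * (L : ℝ) * α L))) / ef L ^ 2) * B₀ L ^ 2 * α L ≤ M L) ∧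
      -- RC-OF-ROWS: hεC hdomC hselfC hcontrC (regime constant `bH`)
      (∀ L : ℕ, 1 < L → 0 ≤ εC L) ∧ (∀ L : ℕ, 1 < L → 2 * (εC L + a₃ L) ≤ ef L / 2) ∧
      (∀ L : ℕ, 1 < L → bH L * (40 * (2 * (3 * (2 * ef L + 2700 * (L : ℝ) * α L))) / ef L ^ 2) * (εC L + a₃ L) ^ 2 ≤ εC L) ∧
      (∀ L : ℕ, 1 < L → 4 * bH L * (40 * (2 * (3 * (2 * ef L + 2700 * (L : ℝ) * α L))) / ef L ^ 2) * (εC L + a₃ L) < 1) ∧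
      -- PROP4-W80 (✓p683940): hR16, hC4
      (∀ L, 1 < L → a₃ L ≤ (1 - 4 * bH L * (40 * (2 * (3 * (2 * ef L + 2700 * (L : ℝ) * α L))) / ef L ^ 2) * (εC L + a₃ L)) * (1 / 16)) ∧
      (∀ L, 1 < L → Mρ * Mτ * θ₃ L * α L + (N₁ L * (40 * (2 * (3 * (2 * ef L + 2700 * (L : ℝ) * α L))) / ef L ^ 2) * (1 / (1 - 4 * bH L * (40 * (2 * (3 * (2 * ef L + 2700 * (L : ℝ) * α L))) / ef L ^ 2) * (εC L + a₃ L))) ^ 2 + Mρ * Mτ * θE' L)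
            + Mρ * Mτ * θE L * (N₁ L * (40 * (2 * (3 * (2 * ef L + 2700 * (L : ℝ) * α L))) / ef L ^ 2) * (1 / (1 - 4 * bH L * (40 * (2 * (3 * (2 * ef L + 2700 * (L : ℝ) * α L))) / ef L ^ 2) * (εC L + a₃ L))) ^ 2) * a₃ L
            + Mρ * Mτ * (1 + θE L * a₃ L) * CV L * (1 / (1 - 4 * bH L * (40 * (2 * (3 * (2 * ef L + 2700 * (L : ℝ) * α L))) / ef L ^ 2) * (εC L + a₃ L))) ^ 2 ≤ C₄ L) := by
  classical
  -- the witnesses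
  let ef : ℕ → ℝ := fun L => 1 / (356 * 10 ^ 7 * (L : ℝ) ^ 3)
  let α₀ : ℕ → ℝ := fun L => ef L / (2700 * (L : ℝ))
  let a₃ : ℕ → ℝ := fun L => ef L / (8000 * (bH L + 1))
  -- the `prop4` constant, OPAQUE with its defining equation (keeps the kernel's `isDefEq` work small)
  obtain ⟨C₄, hC₄eq⟩ : ∃ C₄ : ℕ → ℝ, ∀ L, C₄ L = Mρ * Mτ * θ₃ L * 1 + (N₁ L * (720 / ef L) * (25 / 7) ^ 2 + Mρ * Mτ * θE' L)
      + Mρ * Mτ * θE L * (N₁ L * (720 / ef L) * (25 / 7) ^ 2) * a₃ L + Mρ * Mτ * (1 + θE L * a₃ L) * CV L * (25 / 7) ^ 2 + 1 := ⟨_, fun L => rfl⟩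
  let r : ℕ → ℝ := fun L => min (a₃ L / 4) (1 / (16 * B₀ L * C₄ L))
  let M : ℕ → ℝ := fun L => 11 * B₀ L + 4 * B₀ L * (720 / ef L) * (11 * B₀ L) ^ 2 * α₀ L + ((1 + 25 * C₄ L * B₀ L ^ 2) + cC L * (1 + 25 * C₄ L * B₀ L ^ 2)
      + c137 L * 2 + kTJ L * (10 * B₀ L) / 2 + 14 * (10 * B₀ L) + k349 L * (10 * B₀ L) / 2 + 2 * (10 * B₀ L))
      + 100 * (c137π L + k139π L * B₀ L + k349 L * B₀ L + (28 + 4) * α₀ L * B₀ L) * (720 / ef L) * B₀ L ^ 2 * α₀ L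
  let α : ℕ → ℝ := fun L => (1 / 2) * min (min (α₀ L) (ef L / M L)) (min (r L / (2 * B₀ L)) (1 / (13 * 10 ^ 14 * (L : ℝ) ^ 3)))
  let ε' : ℕ → ℝ := fun L => 2 * (r L + 2 * B₀ L * α L)
  -- positivity of the witnesses and the elementary comparisons, at each `L > 1`
  have hLr : ∀ L : ℕ, 1 < L → (1 : ℝ) ≤ (L : ℝ) := fun L hL => by exact_mod_cast hL.le
  have hef : ∀ L : ℕ, 1 < L → 0 < ef L := fun L hL => by
    have := hLr L hL; simp only [ef]; positivity
  have hbH1 : ∀ L : ℕ, 1 < L → 0 < bH L + 1 := fun L hL => by linarith [hB₀ L hL, hbH L hL]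
  have hbH0 : ∀ L : ℕ, 1 < L → 0 < bH L := fun L hL => lt_of_lt_of_le (hB₀ L hL) (hbH L hL)
  have ha₃ : ∀ L : ℕ, 1 < L → 0 < a₃ L := fun L hL => by
    have := hef L hL; have := hbH1 L hL; simp only [a₃]; positivity
  have hα₀ : ∀ L : ℕ, 1 < L → 0 < α₀ L := fun L hL => by
    have := hef L hL; have := hLr L hL; simp only [α₀]; positivity
  have hC₄ : ∀ L : ℕ, 1 < L → 0 < C₄ L := fun L hL => by
    have := hef L hL; have := ha₃ L hL; have := hN₁0 L hL; have := hθ₃ L hL; have := hθE L hL; have := hθE' L hL; have := hCV L hL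
    rw [hC₄eq]; positivity
  have hr : ∀ L : ℕ, 1 < L → 0 < r L := fun L hL => by
    have := ha₃ L hL; have := hB₀ L hL; have := hC₄ L hL
    simp only [r]; exact lt_min (by positivity) (by positivity)
  have hM : ∀ L : ℕ, 1 < L → 0 < M L := fun L hL => by
    obtain ⟨h1, h2, h3, h4, h5, h6⟩ := hk L hL
    have := hef L hL; have := hB₀ L hL; have := hC₄ L hL; have := hα₀ L hL
    simp only [M]; positivity
  have hα : ∀ L : ℕ, 1 < L → 0 < α L := fun L hL => by
    have := hef L hL; have := hM L hL; have := hr L hL; have := hB₀ L hL; have := hα₀ L hL; have := hLr L hL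
    simp only [α]
    refine mul_pos (by norm_num) (lt_min (lt_min ‹0 < α₀ L› (by positivity)) (lt_min (by positivity) (by positivity)))
  -- the four caps on `α`
  have hα_le₀ : ∀ L : ℕ, 1 < L → α L ≤ α₀ L / 2 := fun L hL => by
    simp only [α]
    have : min (min (α₀ L) (ef L / M L)) (min (r L / (2 * B₀ L)) (1 / (13 * 10 ^ 14 * (L : ℝ) ^ 3))) ≤ α₀ L := (min_le_left _ _).trans (min_le_left _ _)
    linarith
  have hα_leM : ∀ L : ℕ, 1 < L → α L ≤ (ef L / M L) / 2 := fun L hL => by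
    simp only [α]
    have : min (min (α₀ L) (ef L / M L)) (min (r L / (2 * B₀ L)) (1 / (13 * 10 ^ 14 * (L : ℝ) ^ 3))) ≤ ef L / M L := (min_le_left _ _).trans (min_le_right _ _)
    linarith
  have hα_ler : ∀ L : ℕ, 1 < L → α L ≤ (r L / (2 * B₀ L)) / 2 := fun L hL => by
    simp only [α]
    have : min (min (α₀ L) (ef L / M L)) (min (r L / (2 * B₀ L)) (1 / (13 * 10 ^ 14 * (L : ℝ) ^ 3))) ≤ r L / (2 * B₀ L) := (min_le_right _ _).trans (min_le_left _ _)
    linarith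
  have hα_leQ : ∀ L : ℕ, 1 < L → α L ≤ (1 / (13 * 10 ^ 14 * (L : ℝ) ^ 3)) / 2 := fun L hL => by
    simp only [α]
    have : min (min (α₀ L) (ef L / M L)) (min (r L / (2 * B₀ L)) (1 / (13 * 10 ^ 14 * (L : ℝ) ^ 3))) ≤ 1 / (13 * 10 ^ 14 * (L : ℝ) ^ 3) :=
      (min_le_right _ _).trans (min_le_right _ _)
    linarith
  -- derived comparisons
  have hα_le_α₀ : ∀ L : ℕ, 1 < L → α L ≤ α₀ L := fun L hL => by linarith [hα_le₀ L hL, hα₀ L hL]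
  have h2700 : ∀ L : ℕ, 1 < L → 2700 * (L : ℝ) * α L ≤ ef L := fun L hL => by
    have hL0 : (0 : ℝ) < L := by linarith [hLr L hL]
    have h := hα_le_α₀ L hL
    simp only [α₀] at h
    rw [le_div_iff₀ (by positivity)] at h
    linarith
  have hC₂ : ∀ L : ℕ, 1 < L → 40 * (2 * (3 * (2 * ef L + 2700 * (L : ℝ) * α L))) / ef L ^ 2 ≤ 720 / ef L := fun L hL =>
    C₂_le (hef L hL) (h2700 L hL)
  have hC₂0 : ∀ L : ℕ, 1 < L → 0 ≤ 40 * (2 * (3 * (2 * ef L + 2700 * (L : ℝ) * α L))) / ef L ^ 2 := fun L hL =>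
    C₂_nonneg (hef L hL) (by linarith [hLr L hL]) (hα L hL).le
  have hα_le_ef : ∀ L : ℕ, 1 < L → α L ≤ ef L := fun L hL => by
    have h := h2700 L hL
    have hL1 := hLr L hL
    nlinarith [hα L hL]
  have hef_le_one : ∀ L : ℕ, 1 < L → ef L ≤ 1 := fun L hL => by
    have hL1 := hLr L hL
    have hL0 : (0 : ℝ) < L := by linarith
    simp only [ef]
    rw [div_le_one (by positivity)]
    nlinarith [one_le_pow₀ (n := 3) hL1]
  have hα_le_one : ∀ L : ℕ, 1 < L → α L ≤ 1 := fun L hL => (hα_le_ef L hL).trans (hef_le_one L hL)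
  have hr_le_a₃ : ∀ L : ℕ, 1 < L → r L ≤ a₃ L / 4 := fun L hL => min_le_left _ _
  have hr_le_C₄ : ∀ L : ℕ, 1 < L → r L ≤ 1 / (16 * B₀ L * C₄ L) := fun L hL => min_le_right _ _
  have h2B₀α : ∀ L : ℕ, 1 < L → 2 * B₀ L * α L ≤ r L / 2 := fun L hL => by
    have h := hα_ler L hL
    have hB := hB₀ L hL
    rw [div_div, le_div_iff₀ (by positivity)] at h
    linarith
  have hε'_le : ∀ L : ℕ, 1 < L → ε' L ≤ a₃ L := fun L hL => by
    simp only [ε']; linarith [h2B₀α L hL, hr_le_a₃ L hL, (ha₃ L hL).le]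
  have hε'0 : ∀ L : ℕ, 1 < L → 0 ≤ ε' L := fun L hL => by
    have := hr L hL; have := hB₀ L hL; have := hα L hL; simp only [ε']; positivity
  refine ⟨ef, α, a₃, r, ε', a₃, C₄, M, hef, hα, ha₃, hr, hC₄, hM, ?_, ?_, ?_, ?_, ?_, ?_, ?_, ?_, ?_, ?_, ?_, ?_, ?_, ?_, ?_, ?_, ?_, ?_⟩
  -- hWQ
  · intro L hL
    have h := hα_leQ L hL
    have hL0 : (0 : ℝ) < L := by linarith [hLr L hL]
    rw [div_div, le_div_iff₀ (by positivity)] at h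
    linarith
  -- hWe
  · intro L hL
    exact row_hWe (hLr L hL)
  -- hWε
  · intro L hL
    have h := hα_leQ L hL
    have hL0 : (0 : ℝ) < L := by linarith [hLr L hL]
    rw [div_div, le_div_iff₀ (by positivity)] at h
    nlinarith [hα L hL, pow_pos hL0 3]
  -- hMe
  · intro L hL
    have h := hα_leM L hL
    have hM' := hM L hL
    rw [div_div, le_div_iff₀ (by positivity)] at h
    nlinarith [hef L hL]
  -- hw137
  · intro L hL
    have hL0 : (0 : ℝ) < L := by linarith [hLr L hL]
    exact row_hw137 hL0 (hα_le_ef L hL)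
  -- hq47
  · intro L hL
    exact row_hq47 (hef L hL) (hB₀ L hL) (hbH L hL) (hC₂ L hL) (hε'0 L hL) (hε'_le L hL) rfl
  -- hR6
  · intro L hL
    exact row_hR6 (hef L hL) (hbH0 L hL) (hε'_le L hL) rfl
  -- hrε2
  · intro L hL
    exact le_rfl
  -- hrα
  · intro L hL
    linarith [h2B₀α L hL, hr L hL]
  -- hr4
  · intro L hL
    linarith [hr_le_a₃ L hL]
  -- hr16
  · intro L hL
    have h := hr_le_C₄ L hL
    have := hB₀ L hL; have := hC₄ L hL
    rw [le_div_iff₀ (by positivity)] at h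
    linarith
  -- hMdoor
  · intro L hL
    obtain ⟨-, -, -, h4, h5, h6⟩ := hk L hL
    exact row_hMdoor (hef L hL) (hB₀ L hL) (hα L hL).le (hα_le_α₀ L hL) (hC₂0 L hL) (hC₂ L hL) h4 h5 h6
  -- hεC
  · intro L hL
    exact (ha₃ L hL).le
  -- hdomC
  · intro L hL
    exact row_hdomC (hef L hL) (hbH0 L hL) rfl
  -- hselfC
  · intro L hL
    exact row_hselfC (hef L hL) (hbH0 L hL) (hC₂ L hL) rfl
  -- hcontrC
  · intro L hL
    exact row_hcontrC (hef L hL) (hbH0 L hL) (hC₂ L hL) rfl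
  -- hR16 (PROP4-W80)
  · intro L hL
    exact row_hR16 (hLr L hL) rfl (hbH0 L hL) (hC₂ L hL) rfl
  -- hC4 (PROP4-W80)
  · intro L hL
    have h := row_hC4 (θE' L) (hef L hL) (hbH0 L hL) (hC₂ L hL) (rfl : a₃ L = ef L / (8000 * (bH L + 1))) (hα_le_one L hL)
      hMρ0 hMτ0 (hθ₃ L hL) (hθE L hL) (hN₁0 L hL) (hCV L hL)
    rw [hC₄eq]
    linarith

end Summit.QuantumFields.YangMills.Theorems.Prop7NumericWindowsInhabited

end
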